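import Literature.MathematicalPhysics.StatisticalMechanics.BarlowStackingEnergy
import Literature.MathematicalPhysics.StatisticalMechanics.OneCrossingMixture
import Literature.Algebra.EuclideanLattices.CosetGaussianMass

/-!
# `PeriodicGivenLayered` (stmt-AtomisticToContinuum-11779), line `Sketch`, stub `stub_registry`, helper 1

The Lennard-Jones registry coupling as a one-crossing Gaussian transform (card
`alternating-majorisation-one-crossing`), part 1: the in-plane Gaussian layer sum
`θ^a_δ(t) = ∑_{(i,j) ∈ ℤ²} e^{-t ‖i u + j v + δ w‖²}`, written WITHOUT new definitions as the layer interaction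
`layerInteraction (fun r => Real.exp (-t * r ^ 2)) a 0 δ 0` of `BarlowStackingEnergy.lean` (the form used in
`HcpThetaUniversalityBarlowThetaDominance.lean`). Proved here: the coset inequality `θ^a_δ ≤ θ^a_0`
(`CosetGaussianMass.lean`), summability and monotonicity in `t`, the crude bound `θ^a_δ(t) ≤ (1 + 4/(a²t))²`
(product of two geometric series), the Fubini identity
`∑_{(i,j)} n!/(‖i u + j v + δ w‖² + H²)ⁿ⁺¹ = ∫_0^∞ tⁿ e^{-tH²} θ^a_δ(t) dt` (`reg_hasSum_inv_pow_integral`,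
Euler's integral termwise + `hasSum_integral_of_summable_integral_norm`) and the integrability of
`tⁿ e^{-ts} θ^a_δ(t)` on `(0, ∞)` for `n ≥ 2`, `s > 0`. Part 2 (`…Registry2.lean`) turns these into
`barlowCoupling lennardJones a H 1 = ∫_0^∞ (θ^a_0 - θ^a_1)(t) (t⁵/1440 - t²/12) e^{-tH²} dt`.
-/

noncomputable section

namespace Summit.AtomisticToContinuum.Crystallization.Theorems.LayeredHull

open MeasureTheory Set Real Filter
open scoped BigOperators Nat
open Literature.MathematicalPhysics.StatisticalMechanics Literature.Algebra.EuclideanLattices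

/-! ## Geometry of the layer vectors -/

/-- In-plane squared norm at unit spacing: `‖i u + j v + δ w‖² = (i + j/2 + δ/2)² + ¾ (j + δ/3)²`. [folklore] -/
theorem reg_norm_layerVec_one_sq (δ i j : ℤ) :
    ‖layerVec 1 0 δ 0 i j‖ ^ 2 = ((i : ℝ) + j / 2 + δ / 2) ^ 2 + 3 / 4 * ((j : ℝ) + δ / 3) ^ 2 := by
  rw [norm_layerVec, Real.sq_sqrt (by positivity)]
  push_cast
  have h3 : Real.sqrt 3 ^ 2 = 3 := Real.sq_sqrt (by norm_num)
  nlinarith [h3]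

/-- Pythagoras: `‖i u + j v + δ w + H e₃‖² = ‖i u + j v + δ w‖² + H²`. [folklore] -/
theorem reg_norm_layerVec_height_sq (a H : ℝ) (δ i j : ℤ) :
    ‖layerVec a H δ 1 i j‖ ^ 2 = ‖layerVec a 0 δ 0 i j‖ ^ 2 + H ^ 2 := by
  rw [norm_layerVec, norm_layerVec, Real.sq_sqrt (by positivity), Real.sq_sqrt (by positivity)]
  push_cast
  ring

/-- Scaling of the in-plane norms: `‖layerVec a 0 δ 0 i j‖² = a² ‖layerVec 1 0 δ 0 i j‖²`. [folklore] -/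
theorem reg_norm_layerVec_scale_sq (a : ℝ) (δ i j : ℤ) :
    ‖layerVec a 0 δ 0 i j‖ ^ 2 = a ^ 2 * ‖layerVec 1 0 δ 0 i j‖ ^ 2 := by
  rw [norm_layerVec, norm_layerVec, Real.sq_sqrt (by positivity), Real.sq_sqrt (by positivity)]
  push_cast
  ring

/-- Coercivity on the two cosets that occur: for `δ ∈ {0, 1}` and integers `i, j`,
`(i² + j²)/8 ≤ ‖i u + j v + δ w‖²` (unit spacing). [folklore] -/
theorem reg_sq_le_norm_layerVec_one_sq (δ : ℤ) (hδ : δ = 0 ∨ δ = 1) (i j : ℤ) :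
    ((i : ℝ) ^ 2 + j ^ 2) / 8 ≤ ‖layerVec 1 0 δ 0 i j‖ ^ 2 := by
  rw [reg_norm_layerVec_one_sq]
  rcases hδ with rfl | rfl
  · push_cast
    nlinarith [sq_nonneg ((i : ℝ) + j)]
  · push_cast
    by_cases h0 : i = 0 ∧ j = 0
    · obtain ⟨rfl, rfl⟩ := h0
      norm_num
    · have h1 : (1 : ℝ) ≤ (i : ℝ) ^ 2 + j ^ 2 := by
        have : (1 : ℤ) ≤ i ^ 2 + j ^ 2 := by
          rcases not_and_or.1 h0 with hi | hj
          · have := Int.one_le_abs hi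
            nlinarith [abs_mul_abs_self i, sq_nonneg j, abs_nonneg i]
          · have := Int.one_le_abs hj
            nlinarith [abs_mul_abs_self j, sq_nonneg i, abs_nonneg j]
        exact_mod_cast this
      nlinarith [sq_nonneg ((i : ℝ) + j + 1)]

/-- `layerVec a 0 δ 0 i j = i u + j v - (-(δ w))`, the shape of `CosetGaussianMass.lean`. [folklore] -/
theorem reg_layerVec_eq_sub (a : ℝ) (δ i j : ℤ) :
    layerVec a 0 δ 0 i j =
      (i : ℝ) • triangularVec₁ a + (j : ℝ) • triangularVec₂ a - (-((δ : ℝ) • barlowOffset a)) := by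
  simp [layerVec]

/-! ## Summability over `ℤ × ℤ` -/

/-- `∑_{n ∈ ℤ} (c n² + d)⁻¹ < ∞` for `c, d > 0`. [folklore] -/
theorem reg_summable_inv_sq_add (c d : ℝ) (hc : 0 < c) (hd : 0 < d) :
    Summable fun n : ℤ => (c * (n : ℝ) ^ 2 + d)⁻¹ := by
  have h2 : Summable fun n : ℤ => c⁻¹ * (1 / (n : ℝ) ^ 2) :=
    (Real.summable_one_div_int_pow.mpr (by norm_num)).mul_left _
  refine Summable.of_norm_bounded_eventually h2 ?_
  refine Filter.eventually_cofinite.2 ((Set.finite_singleton (0 : ℤ)).subset fun n hn => ?_)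
  simp only [mem_setOf_eq, not_le] at hn
  by_contra h0
  have hn2 : (0 : ℝ) < (n : ℝ) ^ 2 := by
    have : (n : ℝ) ≠ 0 := by exact_mod_cast h0
    positivity
  have hle : ‖(c * (n : ℝ) ^ 2 + d)⁻¹‖ ≤ c⁻¹ * (1 / (n : ℝ) ^ 2) := by
    rw [Real.norm_of_nonneg (by positivity), one_div, ← mul_inv]
    exact inv_anti₀ (by positivity) (by linarith)
  linarith

/-- Summability of inverse powers of a coercive function on `ℤ × ℤ`: if `q(i,j) ≥ c (i² + j²)` with
`c > 0`, then `∑ ((q + d)ᵖ)⁻¹ < ∞` for `d > 0`, `p ≥ 2` (comparison with a product of two series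
`∑ (c n² + d/2)⁻¹`). [folklore] -/
theorem reg_summable_inv_pow (q : ℤ × ℤ → ℝ) (c d : ℝ) (hc : 0 < c) (hd : 0 < d)
    (hq : ∀ ij, c * ((ij.1 : ℝ) ^ 2 + ij.2 ^ 2) ≤ q ij) (p : ℕ) (hp : 2 ≤ p) :
    Summable fun ij : ℤ × ℤ => ((q ij + d) ^ p)⁻¹ := by
  have h1 := reg_summable_inv_sq_add c (d / 2) hc (by positivity)
  have hF : Summable fun ij : ℤ × ℤ =>
      (c * (ij.1 : ℝ) ^ 2 + d / 2)⁻¹ * (c * (ij.2 : ℝ) ^ 2 + d / 2)⁻¹ :=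
    h1.mul_of_nonneg h1 (fun n => by positivity) (fun n => by positivity)
  refine (hF.mul_left ((d ^ (p - 2))⁻¹)).of_nonneg_of_le (fun ij => ?_) (fun ij => ?_)
  · have : 0 ≤ q ij + d := by nlinarith [hq ij, sq_nonneg (ij.1 : ℝ), sq_nonneg (ij.2 : ℝ)]
    positivity
  · obtain ⟨i, j⟩ := ij
    have hq' := hq (i, j)
    simp only at hq' ⊢
    set Q := q (i, j)
    have hX : 0 < c * (i : ℝ) ^ 2 + d / 2 := by positivity
    have hY : 0 < c * (j : ℝ) ^ 2 + d / 2 := by positivity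
    have hXY : c * (i : ℝ) ^ 2 + d / 2 + (c * (j : ℝ) ^ 2 + d / 2) ≤ Q + d := by linarith
    have hQd : d ≤ Q + d := by nlinarith [sq_nonneg (i : ℝ), sq_nonneg (j : ℝ)]
    obtain ⟨m, rfl⟩ : ∃ m, p = m + 2 := ⟨p - 2, by omega⟩
    have h2 : d ^ m ≤ (Q + d) ^ m := pow_le_pow_left₀ hd.le hQd m
    have h3 : (c * (i : ℝ) ^ 2 + d / 2) * (c * (j : ℝ) ^ 2 + d / 2) ≤ (Q + d) ^ 2 := by
      have h4 : (c * (i : ℝ) ^ 2 + d / 2 + (c * (j : ℝ) ^ 2 + d / 2)) ^ 2 ≤ (Q + d) ^ 2 :=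
        pow_le_pow_left₀ (by positivity) hXY 2
      nlinarith [mul_pos hX hY]
    rw [Nat.add_sub_cancel, show m + 2 = 2 + m by ring, pow_add, mul_inv]
    have h5 : ((Q + d) ^ 2)⁻¹ ≤ ((c * (i : ℝ) ^ 2 + d / 2) * (c * (j : ℝ) ^ 2 + d / 2))⁻¹ :=
      inv_anti₀ (mul_pos hX hY) h3
    have h6 : ((Q + d) ^ m)⁻¹ ≤ (d ^ m)⁻¹ := inv_anti₀ (pow_pos hd m) h2
    calc ((Q + d) ^ 2)⁻¹ * ((Q + d) ^ m)⁻¹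
        ≤ ((c * (i : ℝ) ^ 2 + d / 2) * (c * (j : ℝ) ^ 2 + d / 2))⁻¹ * (d ^ m)⁻¹ :=
          mul_le_mul h5 h6 (inv_nonneg.2 (pow_nonneg (hd.le.trans hQd) m)) (by positivity)
      _ = (d ^ m)⁻¹ * ((c * (i : ℝ) ^ 2 + d / 2)⁻¹ * (c * (j : ℝ) ^ 2 + d / 2)⁻¹) := by
          rw [mul_inv, mul_comm]

/-! ## The in-plane Gaussian layer sums `θ^a_δ(t) = layerInteraction (r ↦ e^{-t r²}) a 0 δ 0` -/

/-- Unfolding: `θ^a_δ(t) = ∑'_{(i,j)} e^{-t ‖layerVec a 0 δ 0 i j‖²}`. [folklore] -/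
theorem reg_theta_def (a : ℝ) (δ : ℤ) (t : ℝ) :
    layerInteraction (fun r => Real.exp (-t * r ^ 2)) a 0 δ 0 = ∑' ij : ℤ × ℤ, Real.exp (-t * ‖layerVec a 0 δ 0 ij.1 ij.2‖ ^ 2) := rfl

/-- The coset Gaussian facts of `CosetGaussianMass.lean` for the triangular layer `ℤ u + ℤ v` (`a ≠ 0`, whose
generators `u = (a,0,0)`, `v = (a/2, a√3/2, 0)` are linearly independent): for `t > 0` and any shift `x`, the
shifted layer Gaussian is summable and its sum is at most the unshifted one. [folklore] -/
theorem reg_gauss_layer {a : ℝ} (ha : a ≠ 0) {t : ℝ} (ht : 0 < t) (x : EuclideanSpace ℝ (Fin 3)) :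
    (Summable fun ij : ℤ × ℤ =>
        Real.exp (-t * ‖(ij.1 : ℝ) • triangularVec₁ a + (ij.2 : ℝ) • triangularVec₂ a - x‖ ^ 2)) ∧
      ∑' ij : ℤ × ℤ, Real.exp (-t * ‖(ij.1 : ℝ) • triangularVec₁ a + (ij.2 : ℝ) • triangularVec₂ a - x‖ ^ 2) ≤
        ∑' ij : ℤ × ℤ, Real.exp (-t * ‖(ij.1 : ℝ) • triangularVec₁ a + (ij.2 : ℝ) • triangularVec₂ a‖ ^ 2) := by
  have hli : LinearIndependent ℝ ![triangularVec₁ a, triangularVec₂ a] := by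
    refine LinearIndependent.pair_iff.2 fun p q hpq => ?_
    have h0 := congrArg (fun v : EuclideanSpace ℝ (Fin 3) => v 0) hpq
    have h1 := congrArg (fun v : EuclideanSpace ℝ (Fin 3) => v 1) hpq
    simp [triangularVec₁, triangularVec₂] at h0 h1
    rcases h1 with h1 | h1
    · subst h1
      have : p * a = 0 := by linarith
      rcases mul_eq_zero.1 this with h | h
      · exact ⟨h, rfl⟩
      · exact absurd h ha
    · exact absurd h1 ha
  exact ⟨summable_exp_neg_mul_norm_zsmul_add_zsmul_sub_sq hli ht x,
    tsum_exp_neg_mul_norm_zsmul_add_zsmul_sub_sq_le hli ht x⟩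

/-- Summability of `(i,j) ↦ exp (-t ‖i u + j v + δ w‖²)` for `t > 0`, `a ≠ 0`. [folklore] -/
theorem reg_summable_theta {a : ℝ} (ha : a ≠ 0) (δ : ℤ) {t : ℝ} (ht : 0 < t) :
    Summable fun ij : ℤ × ℤ => Real.exp (-t * ‖layerVec a 0 δ 0 ij.1 ij.2‖ ^ 2) := by
  refine (reg_gauss_layer ha ht (-((δ : ℝ) • barlowOffset a))).1.congr fun ij => ?_
  rw [reg_layerVec_eq_sub]

/-- **Positivity of the aligned-minus-offset Gaussian layer sum**: `θ^a_δ(t) ≤ θ^a_0(t)` (Banaszczyk's coset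
inequality, `tsum_exp_neg_mul_norm_zsmul_add_zsmul_sub_sq_le`). [folklore] -/
theorem reg_theta_le_theta_zero {a : ℝ} (ha : a ≠ 0) (δ : ℤ) {t : ℝ} (ht : 0 < t) :
    layerInteraction (fun r => Real.exp (-t * r ^ 2)) a 0 δ 0 ≤ layerInteraction (fun r => Real.exp (-t * r ^ 2)) a 0 0 0 := by
  have h := (reg_gauss_layer ha ht (-((δ : ℝ) • barlowOffset a))).2
  rw [reg_theta_def, reg_theta_def]
  convert h using 1
  · exact tsum_congr fun ij => by rw [reg_layerVec_eq_sub]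
  · refine tsum_congr fun ij => ?_
    rw [reg_layerVec_eq_sub]
    simp

/-- The layer sums are non-negative. [folklore] -/
theorem reg_theta_nonneg (a : ℝ) (δ : ℤ) (t : ℝ) : 0 ≤ layerInteraction (fun r => Real.exp (-t * r ^ 2)) a 0 δ 0 :=
  tsum_nonneg fun _ => (Real.exp_pos _).le

/-- The layer sums are non-increasing in `t` on `(0, ∞)`. [folklore] -/
theorem reg_theta_antitoneOn {a : ℝ} (ha : a ≠ 0) (δ : ℤ) :
    AntitoneOn (fun t : ℝ => layerInteraction (fun r => Real.exp (-t * r ^ 2)) a 0 δ 0) (Ioi 0) := by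
  intro t₁ ht₁ t₂ ht₂ h12
  exact Summable.tsum_le_tsum (fun ij => Real.exp_le_exp.2 (by nlinarith [sq_nonneg ‖layerVec a 0 δ 0 ij.1 ij.2‖]))
    (reg_summable_theta ha δ ht₂) (reg_summable_theta ha δ ht₁)

/-! ## A crude bound: `θ^a_δ(t) ≤ (1 + 4/(a²t))²` -/

/-- The two-sided geometric series `∑_{n ∈ ℤ} r^{|n|} = (1 + r)/(1 - r)` for `0 ≤ r < 1`. [folklore] -/
theorem reg_hasSum_geom_int {r : ℝ} (hr0 : 0 ≤ r) (hr1 : r < 1) :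
    HasSum (fun n : ℤ => r ^ n.natAbs) ((1 + r) / (1 - r)) := by
  have h1 : HasSum (fun n : ℕ => r ^ n) (1 - r)⁻¹ := hasSum_geometric_of_lt_one hr0 hr1
  have h2 : HasSum (fun n : ℕ => r ^ (n + 1)) (r * (1 - r)⁻¹) := by
    simpa [pow_succ, mul_comm] using h1.mul_left r
  have e2 : ∀ n : ℕ, (-((n : ℤ) + 1)).natAbs = n + 1 := fun n => by omega
  have h2' : HasSum (fun n : ℕ => r ^ (-((n : ℤ) + 1)).natAbs) (r * (1 - r)⁻¹) := by
    simpa only [e2] using h2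
  have h := HasSum.of_nat_of_neg_add_one (f := fun n : ℤ => r ^ n.natAbs) (by simpa using h1) h2'
  have hr : 1 - r ≠ 0 := by linarith
  convert h using 1
  field_simp

/-- The one-dimensional Gaussian sum is dominated by the geometric one:
`∑_{n ∈ ℤ} e^{-c n²} ≤ (1 + e^{-c})/(1 - e^{-c})` for `c > 0` (with summability). [folklore] -/
theorem reg_tsum_exp_neg_mul_sq_le {c : ℝ} (hc : 0 < c) :
    Summable (fun n : ℤ => Real.exp (-(c * (n : ℝ) ^ 2))) ∧
      ∑' n : ℤ, Real.exp (-(c * (n : ℝ) ^ 2)) ≤ (1 + Real.exp (-c)) / (1 - Real.exp (-c)) := by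
  set r := Real.exp (-c) with hr
  have hr0 : 0 ≤ r := (Real.exp_pos _).le
  have hr1 : r < 1 := Real.exp_lt_one_iff.2 (by linarith)
  have hg := reg_hasSum_geom_int hr0 hr1
  have hle : ∀ n : ℤ, Real.exp (-(c * (n : ℝ) ^ 2)) ≤ r ^ n.natAbs := fun n => by
    rw [hr, ← Real.exp_nat_mul, Real.exp_le_exp, Nat.cast_natAbs]
    push_cast
    have habs : |(n : ℝ)| ≤ (n : ℝ) ^ 2 := by
      rcases eq_or_ne n 0 with rfl | hn
      · simp
      · have h1 : (1 : ℝ) ≤ |(n : ℝ)| := by exact_mod_cast Int.one_le_abs hn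
        nlinarith [abs_nonneg (n : ℝ), sq_abs (n : ℝ)]
    nlinarith
  have hs : Summable fun n : ℤ => Real.exp (-(c * (n : ℝ) ^ 2)) :=
    hg.summable.of_nonneg_of_le (fun n => (Real.exp_pos _).le) hle
  exact ⟨hs, hasSum_le hle hs.hasSum hg⟩

/-- **Crude bound on the aligned layer sum**: `θ^a_0(t) ≤ (1 + 4/(a²t))²` for `t > 0`, `a ≠ 0`
(`‖i u + j v‖² = a²(i² + ij + j²) ≥ a²(i² + j²)/2`, then the product of two geometric series and
`e^{c} ≥ 1 + c`). [folklore] -/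
theorem reg_theta_zero_le {a : ℝ} (ha : a ≠ 0) {t : ℝ} (ht : 0 < t) :
    layerInteraction (fun r => Real.exp (-t * r ^ 2)) a 0 0 0 ≤ (1 + 4 / (a ^ 2 * t)) ^ 2 := by
  set c := t * a ^ 2 / 2 with hc
  have ha2 : 0 < a ^ 2 := by positivity
  have hc0 : 0 < c := by positivity
  obtain ⟨hs1, hb1⟩ := reg_tsum_exp_neg_mul_sq_le hc0
  have hs1' : Summable fun n : ℤ => ‖Real.exp (-(c * (n : ℝ) ^ 2))‖ :=
    hs1.congr fun n => (Real.norm_of_nonneg (Real.exp_pos _).le).symm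
  have hpt : ∀ ij : ℤ × ℤ, Real.exp (-t * ‖layerVec a 0 0 0 ij.1 ij.2‖ ^ 2) ≤
      Real.exp (-(c * (ij.1 : ℝ) ^ 2)) * Real.exp (-(c * (ij.2 : ℝ) ^ 2)) := fun ij => by
    rw [← Real.exp_add, Real.exp_le_exp, reg_norm_layerVec_scale_sq, reg_norm_layerVec_one_sq]
    push_cast
    nlinarith [mul_nonneg (mul_nonneg ht.le ha2.le) (sq_nonneg ((ij.1 : ℝ) + ij.2))]
  have hprod := tsum_mul_tsum_of_summable_norm hs1' hs1'
  set S := ∑' n : ℤ, Real.exp (-(c * (n : ℝ) ^ 2)) with hS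
  have hS0 : 0 ≤ S := tsum_nonneg fun n => (Real.exp_pos _).le
  set r := Real.exp (-c) with hr
  have hr0 : 0 ≤ r := (Real.exp_pos _).le
  have hr1 : r < 1 := Real.exp_lt_one_iff.2 (by linarith)
  have hrc : r * (c + 1) ≤ 1 := by
    have h1 : r * Real.exp c = 1 := by rw [hr, ← Real.exp_add]; simp
    nlinarith [Real.add_one_le_exp c]
  calc layerInteraction (fun r => Real.exp (-t * r ^ 2)) a 0 0 0 ≤ ∑' ij : ℤ × ℤ, Real.exp (-(c * (ij.1 : ℝ) ^ 2)) * Real.exp (-(c * (ij.2 : ℝ) ^ 2)) :=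
        Summable.tsum_le_tsum hpt (reg_summable_theta ha 0 ht) (summable_mul_of_summable_norm hs1' hs1')
    _ = S * S := hprod.symm
    _ ≤ ((1 + r) / (1 - r)) ^ 2 := by
        rw [← sq]
        exact pow_le_pow_left₀ hS0 hb1 2
    _ ≤ (1 + 4 / (a ^ 2 * t)) ^ 2 := by
        refine pow_le_pow_left₀ (by positivity) ?_ 2
        rw [div_le_iff₀ (by linarith), show 4 / (a ^ 2 * t) = 2 / c by rw [hc]; field_simp; ring]
        rw [show (1 + 2 / c) * (1 - r) = ((c + 2) * (1 - r)) / c by field_simp]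
        rw [le_div_iff₀ hc0]
        nlinarith

/-- `θ^a_δ(t) ≤ (1 + 4/(a²t))²` for every coset `δ`. [folklore] -/
theorem reg_theta_le {a : ℝ} (ha : a ≠ 0) (δ : ℤ) {t : ℝ} (ht : 0 < t) :
    layerInteraction (fun r => Real.exp (-t * r ^ 2)) a 0 δ 0 ≤ (1 + 4 / (a ^ 2 * t)) ^ 2 :=
  (reg_theta_le_theta_zero ha δ ht).trans (reg_theta_zero_le ha ht)

/-! ## Fubini: inverse-power layer sums as transforms of `θ^a_δ` -/

/-- **Inverse-power layer sums are Laplace transforms of the Gaussian layer sum**: for `a > 0`, `H ≠ 0`,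
`δ ∈ {0,1}` and `n ≥ 1`,
`∑_{(i,j)} n! / (‖i u + j v + δ w‖² + H²)ⁿ⁺¹ = ∫_0^∞ tⁿ e^{-tH²} θ^a_δ(t) dt`
(Euler's integral termwise and `hasSum_integral_of_summable_integral_norm`). [folklore] -/
theorem reg_hasSum_inv_pow_integral {a H : ℝ} (ha : 0 < a) (hH : H ≠ 0) (δ : ℤ) (hδ : δ = 0 ∨ δ = 1)
    (n : ℕ) (hn : 1 ≤ n) :
    HasSum (fun ij : ℤ × ℤ => (n ! : ℝ) / (‖layerVec a 0 δ 0 ij.1 ij.2‖ ^ 2 + H ^ 2) ^ (n + 1))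
      (∫ t in Ioi (0 : ℝ), t ^ n * Real.exp (-(t * H ^ 2)) * layerInteraction (fun r => Real.exp (-t * r ^ 2)) a 0 δ 0) := by
  have hH2 : 0 < H ^ 2 := by positivity
  set q : ℤ × ℤ → ℝ := fun ij => ‖layerVec a 0 δ 0 ij.1 ij.2‖ ^ 2 + H ^ 2 with hq
  have hq0 : ∀ ij, 0 < q ij := fun ij => by positivity
  set F : ℤ × ℤ → ℝ → ℝ := fun ij t => Real.exp (-(t * q ij)) * t ^ n with hF
  have hint : ∀ ij, Integrable (F ij) (volume.restrict (Ioi 0)) := fun ij =>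
    integrableOn_exp_neg_mul_mul_pow n (hq0 ij)
  have hnorm : ∀ ij, ∫ t in Ioi (0 : ℝ), ‖F ij t‖ = n ! / (q ij) ^ (n + 1) := fun ij => by
    rw [← integral_exp_neg_mul_mul_pow n (hq0 ij)]
    refine setIntegral_congr_fun measurableSet_Ioi fun t ht => ?_
    have ht' : 0 < t := ht
    exact Real.norm_of_nonneg (by positivity)
  have hsum : Summable fun ij => ∫ t in Ioi (0 : ℝ), ‖F ij t‖ := by
    simp_rw [hnorm]
    have h := reg_summable_inv_pow (fun ij : ℤ × ℤ => ‖layerVec a 0 δ 0 ij.1 ij.2‖ ^ 2) (a ^ 2 / 8) (H ^ 2)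
      (by positivity) hH2 (fun ij => by
        rw [reg_norm_layerVec_scale_sq]
        have := reg_sq_le_norm_layerVec_one_sq δ hδ ij.1 ij.2
        nlinarith [sq_nonneg a]) (n + 1) (by omega)
    simpa [div_eq_mul_inv] using h.mul_left (n ! : ℝ)
  have key := hasSum_integral_of_summable_integral_norm hint hsum
  have hfun : (fun ij => ∫ t in Ioi (0 : ℝ), F ij t) =
      fun ij : ℤ × ℤ => (n ! : ℝ) / (‖layerVec a 0 δ 0 ij.1 ij.2‖ ^ 2 + H ^ 2) ^ (n + 1) :=
    funext fun ij => integral_exp_neg_mul_mul_pow n (hq0 ij)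
  have hval : (∫ t in Ioi (0 : ℝ), ∑' ij : ℤ × ℤ, F ij t) =
      ∫ t in Ioi (0 : ℝ), t ^ n * Real.exp (-(t * H ^ 2)) * layerInteraction (fun r => Real.exp (-t * r ^ 2)) a 0 δ 0 := by
    refine setIntegral_congr_fun measurableSet_Ioi fun t _ => ?_
    have he : ∀ ij : ℤ × ℤ, F ij t =
        Real.exp (-t * ‖layerVec a 0 δ 0 ij.1 ij.2‖ ^ 2) * (Real.exp (-(t * H ^ 2)) * t ^ n) := fun ij => by
      simp only [hF, hq, mul_add, neg_add, Real.exp_add, neg_mul]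
      ring
    rw [tsum_congr he, tsum_mul_right, reg_theta_def]
    ring
  rw [hfun, hval] at key
  exact key

/-- Summability of the inverse-power layer sums `∑ ((‖i u + j v + δ w‖² + H²)ᵖ)⁻¹`, `p ≥ 2`. [folklore] -/
theorem reg_summable_inv_pow_layer {a H : ℝ} (ha : 0 < a) (hH : H ≠ 0) (δ : ℤ) (hδ : δ = 0 ∨ δ = 1)
    (p : ℕ) (hp : 2 ≤ p) :
    Summable fun ij : ℤ × ℤ => ((‖layerVec a 0 δ 0 ij.1 ij.2‖ ^ 2 + H ^ 2) ^ p)⁻¹ := by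
  have hH2 : 0 < H ^ 2 := by positivity
  exact reg_summable_inv_pow (fun ij : ℤ × ℤ => ‖layerVec a 0 δ 0 ij.1 ij.2‖ ^ 2) (a ^ 2 / 8) (H ^ 2)
    (by positivity) hH2 (fun ij => by
      rw [reg_norm_layerVec_scale_sq]
      have := reg_sq_le_norm_layerVec_one_sq δ hδ ij.1 ij.2
      nlinarith [sq_nonneg a]) p hp

/-- **Integrability**: `t ↦ tⁿ e^{-ts} θ^a_δ(t)` is integrable on `(0, ∞)` for `n ≥ 2`, `s > 0`, `a ≠ 0`
(dominated by `(t + 4/a²)² tⁿ⁻² e^{-ts}`; measurable because `θ^a_δ` is monotone). [folklore] -/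
theorem reg_integrableOn_theta_mul {a : ℝ} (ha : a ≠ 0) (δ : ℤ) {s : ℝ} (hs : 0 < s) (n : ℕ) (hn : 2 ≤ n) :
    MeasureTheory.IntegrableOn (fun t => t ^ n * Real.exp (-(t * s)) * layerInteraction (fun r => Real.exp (-t * r ^ 2)) a 0 δ 0) (Set.Ioi 0) := by
  obtain ⟨m, rfl⟩ : ∃ m, n = m + 2 := ⟨n - 2, by omega⟩
  have ha2 : 0 < a ^ 2 := by positivity
  have hmeas : AEStronglyMeasurable (fun t => t ^ (m + 2) * Real.exp (-(t * s)) * layerInteraction (fun r => Real.exp (-t * r ^ 2)) a 0 δ 0)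
      (volume.restrict (Ioi 0)) := by
    refine ((by fun_prop : Continuous fun t : ℝ => t ^ (m + 2) * Real.exp (-(t * s))).aestronglyMeasurable).mul ?_
    exact (aemeasurable_restrict_of_antitoneOn measurableSet_Ioi (reg_theta_antitoneOn ha δ)).aestronglyMeasurable
  have hg : IntegrableOn (fun t : ℝ => Real.exp (-(t * s)) * t ^ (m + 2) +
      8 / a ^ 2 * (Real.exp (-(t * s)) * t ^ (m + 1)) + 16 / a ^ 4 * (Real.exp (-(t * s)) * t ^ m)) (Ioi 0) :=
    (((integrableOn_exp_neg_mul_mul_pow (m + 2) hs).add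
      ((integrableOn_exp_neg_mul_mul_pow (m + 1) hs).const_mul _)).add
      ((integrableOn_exp_neg_mul_mul_pow m hs).const_mul _))
  refine Integrable.mono' hg hmeas ?_
  refine (ae_restrict_iff' measurableSet_Ioi).2 (Eventually.of_forall fun t (ht : 0 < t) => ?_)
  have hθ0 := reg_theta_nonneg a δ t
  have hθ1 := reg_theta_le ha δ ht
  rw [Real.norm_of_nonneg (by positivity)]
  have hexp : 0 < Real.exp (-(t * s)) := Real.exp_pos _
  calc t ^ (m + 2) * Real.exp (-(t * s)) * layerInteraction (fun r => Real.exp (-t * r ^ 2)) a 0 δ 0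
      ≤ t ^ (m + 2) * Real.exp (-(t * s)) * (1 + 4 / (a ^ 2 * t)) ^ 2 := by gcongr
    _ = _ := by
        field_simp
        ring

end Summit.AtomisticToContinuum.Crystallization.Theorems.LayeredHull
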